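import Literature.Barriers.AtomisticToContinuum.DisorderedHarmonicChainInvGamma
import Mathlib.Analysis.SpecialFunctions.Trigonometric.ArctanDeriv
import HarnessLib

/-!
# Ajanki–Huveneers 2011: the differential calculus of the one-step phase map `f_b(x) = x + ϑ + Φ(x,b)`

Companion to `DisorderedHarmonicChainPhases.lean` / `…PhasesProofs.lean` / `…InvGamma.lean`
(O. Ajanki, F. Huveneers, CMP **301** (2011) 841–883, arXiv:1003.1076). This file is the first
of the files discharging the low-frequency upper bound (U) of `…Transfer.lean` by an
integration-by-parts route (see `…DisorderedHarmonicChainDensityUpper.lean`); it isolates the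
exact, division-free calculus of the one-step map of the phase chain.

With `δ = c(w) b` (`igDelta`, App. 7.1 of the paper) and `θ = 2πx`, the phase correction (3.10) is
`πΦ(x,b) = arctan(q/p)`, `q = δ(1 - cos θ)`, `p = 1 - δ sin θ` (`ahPhi_eq_pcPhi`), and
`P := p² + q² = 1 - 2δ sin θ + 2δ²(1 - cos θ)` (`pcP`) is the square of the amplitude factor:
`ahFactor = √P` (`ahFactor_eq_sqrt_pcP`, from the closed form `ig_ahFactor_inv_eq`). PROVED here:

* `∂_x f_b(x) = 1/P(x, δ)` (`hasDerivAt_ahStep_x`): the derivative of the circle map IS the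
  inverse square of the amplitude factor (the Jacobian `|cz+d|⁻²` of the Möbius action), because
  `1 - P = 2δ(sin θ + δ cos θ - δ)` is exactly the numerator of `∂_x arctan(q/p)`
  (`hasDerivAt_pcPhi_x`);
* `∂_b f_b(x) = c(w)(1 - cos θ)/(πP)` (`hasDerivAt_ahStep_b`, from `hasDerivAt_pcPhi_delta`:
  `∂_δ Φ = (1 - cos θ)/(πP)`), so `w sin²(πx)/2 ≤ ∂_b f_b(x) ≤ 4w` for small `w`;
* `∂_x P = -4πδ(cos θ - δ sin θ)`, `∂_δ P = -2 sin θ + 4δ(1 - cos θ)` and the uniform bounds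
  `1/2 ≤ P ≤ 2`, `|log P + 2δ sin θ| ≤ 22δ²` for `|δ| ≤ 1/8`.

These are the only derivatives the integration by parts needs: the first variation of the
`n`-step phase along a suitably normalised vector field is `J̃_n = ∏_{i<n} P_i⁻¹` times a sum of
i.i.d.-driven terms (next files).

[cite: AjankiHuveneers2011, Lemma 3.2 eq. (3.10); Prop. 3.5 eq. (3.19); App. 7.1]
-/

noncomputable section

open Real MeasureTheory

namespace Literature.Barriers.AtomisticToContinuum.HeatConduction

/-! ### The polynomial `P(x, δ)` and its derivatives -/

/-- `P(x,δ) = 1 - 2δ sin 2πx + 2δ²(1 - cos 2πx) = |1 + iδ(1 - e^{-2πix})|²`, the squared amplitude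
factor in the reduced noise variable `δ`. [cite: AjankiHuveneers2011, App. 7.1] -/
def pcP (x δ : ℝ) : ℝ := 1 - 2 * δ * Real.sin (2 * π * x) + 2 * δ ^ 2 * (1 - Real.cos (2 * π * x))

/-- `P = (1 - δ sin θ)² + δ²(1 - cos θ)² = p² + q²`. [folklore] -/
theorem pcP_eq_sq (x δ : ℝ) :
    pcP x δ = (1 - δ * Real.sin (2 * π * x)) ^ 2 + (δ * (1 - Real.cos (2 * π * x))) ^ 2 := by
  unfold pcP
  have h := Real.sin_sq_add_cos_sq (2 * π * x)
  linear_combination (-(δ ^ 2)) * h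

/-- `P = 1 - 4δ sin πx cos πx + 4δ² sin² πx` (the form of `ig_ahFactor_inv_eq`). [folklore] -/
theorem pcP_eq_half_angle (x δ : ℝ) :
    pcP x δ = 1 - 4 * δ * Real.sin (π * x) * Real.cos (π * x) + 4 * δ ^ 2 * Real.sin (π * x) ^ 2 := by
  unfold pcP
  rw [show 2 * π * x = 2 * (π * x) by ring, Real.sin_two_mul, Real.cos_two_mul, Real.cos_sq']
  ring

/-- `P > 0`. [folklore] -/
theorem pcP_pos (x δ : ℝ) : 0 < pcP x δ := by
  rw [pcP_eq_half_angle]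
  exact ig_one_sub_delta_pos δ x

/-- `(1 - |δ|)² ≤ P` for `|δ| ≤ 1`. [folklore] -/
theorem sq_le_pcP {δ : ℝ} (hδ : |δ| ≤ 1) (x : ℝ) : (1 - |δ|) ^ 2 ≤ pcP x δ := by
  rw [pcP_eq_sq]
  have hs : |δ * Real.sin (2 * π * x)| ≤ |δ| := by
    rw [abs_mul]
    exact mul_le_of_le_one_right (abs_nonneg _) (Real.abs_sin_le_one _)
  have h1 : 1 - |δ| ≤ 1 - δ * Real.sin (2 * π * x) := by
    linarith [le_abs_self (δ * Real.sin (2 * π * x))]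
  have h : 0 ≤ 1 - |δ| := by linarith
  nlinarith [sq_nonneg (δ * (1 - Real.cos (2 * π * x))), mul_self_le_mul_self h h1]

/-- `P ≤ (1 + |δ|)² + 4δ²`. [folklore] -/
theorem pcP_le (x δ : ℝ) : pcP x δ ≤ (1 + |δ|) ^ 2 + 4 * δ ^ 2 := by
  rw [pcP_eq_sq]
  have hs : |δ * Real.sin (2 * π * x)| ≤ |δ| := by
    rw [abs_mul]
    exact mul_le_of_le_one_right (abs_nonneg _) (Real.abs_sin_le_one _)
  have hc0 : 0 ≤ 1 - Real.cos (2 * π * x) := by linarith [Real.cos_le_one (2 * π * x)]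
  have hc2 : 1 - Real.cos (2 * π * x) ≤ 2 := by linarith [Real.neg_one_le_cos (2 * π * x)]
  have h1 : (1 - δ * Real.sin (2 * π * x)) ^ 2 ≤ (1 + |δ|) ^ 2 := by
    have ha : |1 - δ * Real.sin (2 * π * x)| ≤ 1 + |δ| := by
      calc |1 - δ * Real.sin (2 * π * x)| ≤ |(1 : ℝ)| + |δ * Real.sin (2 * π * x)| := abs_sub _ _
        _ ≤ 1 + |δ| := by rw [abs_one]; linarith
    calc (1 - δ * Real.sin (2 * π * x)) ^ 2 = |1 - δ * Real.sin (2 * π * x)| ^ 2 := (sq_abs _).symm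
      _ ≤ (1 + |δ|) ^ 2 := pow_le_pow_left₀ (abs_nonneg _) ha 2
  have h2 : (δ * (1 - Real.cos (2 * π * x))) ^ 2 ≤ 4 * δ ^ 2 := by
    have h3 : (1 - Real.cos (2 * π * x)) ^ 2 ≤ 4 := by nlinarith
    calc (δ * (1 - Real.cos (2 * π * x))) ^ 2 = δ ^ 2 * (1 - Real.cos (2 * π * x)) ^ 2 := by ring
      _ ≤ δ ^ 2 * 4 := mul_le_mul_of_nonneg_left h3 (sq_nonneg δ)
      _ = 4 * δ ^ 2 := by ring
  linarith

/-- For `|δ| ≤ 1/4`: `1/2 ≤ P ≤ 2`. [folklore] -/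
theorem pcP_bounds {δ : ℝ} (hδ : |δ| ≤ 1 / 4) (x : ℝ) : 1 / 2 ≤ pcP x δ ∧ pcP x δ ≤ 2 := by
  constructor
  · have h := sq_le_pcP (by linarith : |δ| ≤ 1) x
    nlinarith [abs_nonneg δ]
  · have h := pcP_le x δ
    have : δ ^ 2 ≤ 1 / 16 := by
      have := abs_le.mp hδ
      nlinarith
    nlinarith [abs_nonneg δ]

/-- `∂_x P = -4πδ(cos 2πx - δ sin 2πx)`. [folklore] -/
def pcPx (x δ : ℝ) : ℝ := -(4 * π * δ * (Real.cos (2 * π * x) - δ * Real.sin (2 * π * x)))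

/-- `∂_δ P = -2 sin 2πx + 4δ(1 - cos 2πx)`. [folklore] -/
def pcPd (x δ : ℝ) : ℝ := -2 * Real.sin (2 * π * x) + 4 * δ * (1 - Real.cos (2 * π * x))

/-- `d/dx sin 2πx = 2π cos 2πx`. [folklore] -/
theorem hasDerivAt_sin_two_pi (x : ℝ) :
    HasDerivAt (fun x => Real.sin (2 * π * x)) (2 * π * Real.cos (2 * π * x)) x :=
  (((hasDerivAt_id' x).const_mul (2 * π)).sin).congr_deriv (by ring)

/-- `d/dx cos 2πx = -2π sin 2πx`. [folklore] -/
theorem hasDerivAt_cos_two_pi (x : ℝ) :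
    HasDerivAt (fun x => Real.cos (2 * π * x)) (-(2 * π * Real.sin (2 * π * x))) x :=
  (((hasDerivAt_id' x).const_mul (2 * π)).cos).congr_deriv (by ring)

/-- `HasDerivAt` of `P` in `x`. [folklore] -/
theorem hasDerivAt_pcP_x (x δ : ℝ) : HasDerivAt (fun x => pcP x δ) (pcPx x δ) x := by
  have h1 : HasDerivAt (fun x => 1 - 2 * δ * Real.sin (2 * π * x))
      (-(2 * δ * (2 * π * Real.cos (2 * π * x)))) x :=
    ((hasDerivAt_sin_two_pi x).const_mul (2 * δ)).const_sub 1
  have h2 : HasDerivAt (fun x => 2 * δ ^ 2 * (1 - Real.cos (2 * π * x)))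
      (2 * δ ^ 2 * -(-(2 * π * Real.sin (2 * π * x)))) x :=
    ((hasDerivAt_cos_two_pi x).const_sub 1).const_mul (2 * δ ^ 2)
  have h := h1.add h2
  unfold pcP pcPx
  exact h.congr_deriv (by ring)

/-- `HasDerivAt` of `P` in `δ`. [folklore] -/
theorem hasDerivAt_pcP_delta (x δ : ℝ) : HasDerivAt (fun δ => pcP x δ) (pcPd x δ) δ := by
  have hp2 : HasDerivAt (fun δ : ℝ => δ ^ 2) (2 * δ) δ := by simpa using hasDerivAt_pow 2 δ
  have h1 : HasDerivAt (fun δ : ℝ => 1 - 2 * δ * Real.sin (2 * π * x)) (-(2 * 1 * Real.sin (2 * π * x))) δ :=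
    (((hasDerivAt_id' δ).const_mul 2).mul_const (Real.sin (2 * π * x))).const_sub 1
  have h2 : HasDerivAt (fun δ : ℝ => 2 * δ ^ 2 * (1 - Real.cos (2 * π * x)))
      (2 * (2 * δ) * (1 - Real.cos (2 * π * x))) δ :=
    (hp2.const_mul 2).mul_const (1 - Real.cos (2 * π * x))
  have h := h1.add h2
  unfold pcP pcPd
  exact h.congr_deriv (by ring)

/-- `|∂_x P| ≤ 8π|δ|` for `|δ| ≤ 1`. [folklore] -/
theorem abs_pcPx_le {δ : ℝ} (hδ : |δ| ≤ 1) (x : ℝ) : |pcPx x δ| ≤ 8 * π * |δ| := by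
  unfold pcPx
  rw [abs_neg, show 4 * π * δ * (Real.cos (2 * π * x) - δ * Real.sin (2 * π * x)) =
    (4 * π * δ) * (Real.cos (2 * π * x) - δ * Real.sin (2 * π * x)) by ring, abs_mul]
  have h1 : |4 * π * δ| = 4 * π * |δ| := by
    rw [abs_mul, abs_of_pos (by positivity : 0 < 4 * π)]
  have h2 : |Real.cos (2 * π * x) - δ * Real.sin (2 * π * x)| ≤ 2 := by
    calc |Real.cos (2 * π * x) - δ * Real.sin (2 * π * x)|
        ≤ |Real.cos (2 * π * x)| + |δ * Real.sin (2 * π * x)| := abs_sub _ _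
      _ ≤ 1 + 1 := by
          refine add_le_add (Real.abs_cos_le_one _) ?_
          rw [abs_mul]
          exact mul_le_one₀ hδ (abs_nonneg _) (Real.abs_sin_le_one _)
      _ = 2 := by norm_num
  rw [h1]
  calc 4 * π * |δ| * |Real.cos (2 * π * x) - δ * Real.sin (2 * π * x)| ≤ 4 * π * |δ| * 2 :=
        mul_le_mul_of_nonneg_left h2 (by positivity)
    _ = 8 * π * |δ| := by ring

/-- The leading term of `∂_x P`: `|∂_x P + 4πδ cos 2πx| ≤ 4πδ²`. [folklore] -/
theorem abs_pcPx_add_le (x δ : ℝ) : |pcPx x δ + 4 * π * δ * Real.cos (2 * π * x)| ≤ 4 * π * δ ^ 2 := by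
  unfold pcPx
  have : -(4 * π * δ * (Real.cos (2 * π * x) - δ * Real.sin (2 * π * x))) + 4 * π * δ * Real.cos (2 * π * x)
      = (4 * π * δ ^ 2) * Real.sin (2 * π * x) := by ring
  rw [this, abs_mul, abs_of_nonneg (by positivity : (0:ℝ) ≤ 4 * π * δ ^ 2)]
  exact mul_le_of_le_one_right (by positivity) (Real.abs_sin_le_one _)

/-- `|∂_δ P| ≤ 2 + 8|δ|`. [folklore] -/
theorem abs_pcPd_le (x δ : ℝ) : |pcPd x δ| ≤ 2 + 8 * |δ| := by
  unfold pcPd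
  have hc0 : 0 ≤ 1 - Real.cos (2 * π * x) := by linarith [Real.cos_le_one (2 * π * x)]
  have hc2 : 1 - Real.cos (2 * π * x) ≤ 2 := by linarith [Real.neg_one_le_cos (2 * π * x)]
  calc |-2 * Real.sin (2 * π * x) + 4 * δ * (1 - Real.cos (2 * π * x))|
      ≤ |-2 * Real.sin (2 * π * x)| + |4 * δ * (1 - Real.cos (2 * π * x))| := abs_add_le _ _
    _ ≤ 2 + 8 * |δ| := by
        refine add_le_add ?_ ?_
        · rw [abs_mul, show |(-2:ℝ)| = 2 by norm_num]
          linarith [Real.abs_sin_le_one (2 * π * x)]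
        · rw [abs_mul, abs_mul, show |(4:ℝ)| = 4 by norm_num, abs_of_nonneg hc0]
          nlinarith [abs_nonneg δ]

/-- `|log P + 2δ sin 2πx| ≤ 22δ²` for `|δ| ≤ 1/8` (`log P = -2δ sin θ + 𝒪(δ²)`, eq. (3.19) of the
paper squared). [cite: AjankiHuveneers2011, Prop. 3.5 eq. (3.19)] -/
theorem abs_log_pcP_add_le {δ : ℝ} (hδ : |δ| ≤ 1 / 8) (x : ℝ) :
    |Real.log (pcP x δ) + 2 * δ * Real.sin (2 * π * x)| ≤ 22 * δ ^ 2 := by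
  set s := Real.sin (2 * π * x) with hs
  set c := Real.cos (2 * π * x) with hc
  set y := -(2 * δ * s) + 2 * δ ^ 2 * (1 - c) with hy
  have hP : pcP x δ = 1 + y := by rw [hy]; unfold pcP; ring
  have hδ2 : δ ^ 2 ≤ 1 / 64 := by
    have := abs_le.mp hδ
    nlinarith
  have hs1 : |δ * s| ≤ |δ| := by
    rw [abs_mul]; exact mul_le_of_le_one_right (abs_nonneg _) (Real.abs_sin_le_one _)
  have hc0 : 0 ≤ 1 - c := by rw [hc]; linarith [Real.cos_le_one (2 * π * x)]
  have hc2 : 1 - c ≤ 2 := by rw [hc]; linarith [Real.neg_one_le_cos (2 * π * x)]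
  have hy_abs : |y| ≤ 3 * |δ| := by
    rw [hy]
    calc |-(2 * δ * s) + 2 * δ ^ 2 * (1 - c)| ≤ |-(2 * δ * s)| + |2 * δ ^ 2 * (1 - c)| := abs_add_le _ _
      _ ≤ 2 * |δ| + 4 * δ ^ 2 := by
          refine add_le_add ?_ ?_
          · rw [abs_neg, show 2 * δ * s = 2 * (δ * s) by ring, abs_mul, show |(2:ℝ)| = 2 by norm_num]
            linarith
          · rw [abs_of_nonneg (by positivity)]
            nlinarith [sq_nonneg δ]
      _ ≤ 3 * |δ| := by nlinarith [abs_nonneg δ, sq_abs δ]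
  have hy2 : |y| ≤ 1 / 2 := by linarith
  have hlog0 := abs_log_one_add_sub_le hy2
  have hlog : |Real.log (1 + y) - y| ≤ 2 * y ^ 2 := by
    have e : Real.log (1 + y) - y = (Real.log (1 + y) - (y - y ^ 2 / 2)) - y ^ 2 / 2 := by ring
    rw [e]
    have hy3 : |y| ^ 3 ≤ |y| ^ 2 / 2 := by
      have : |y| ^ 3 = |y| ^ 2 * |y| := by ring
      rw [this]
      nlinarith [sq_nonneg (|y|), abs_nonneg y]
    calc |Real.log (1 + y) - (y - y ^ 2 / 2) - y ^ 2 / 2|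
        ≤ |Real.log (1 + y) - (y - y ^ 2 / 2)| + |y ^ 2 / 2| := abs_sub _ _
      _ ≤ 2 * |y| ^ 3 + y ^ 2 / 2 := by
          refine add_le_add hlog0 ?_
          rw [abs_of_nonneg (by positivity)]
      _ ≤ 2 * y ^ 2 := by rw [← sq_abs y]; nlinarith [sq_nonneg (|y|)]
  rw [hP]
  have e1 : Real.log (1 + y) + 2 * δ * s = (Real.log (1 + y) - y) + 2 * δ ^ 2 * (1 - c) := by
    rw [hy]; ring
  rw [e1]
  calc |Real.log (1 + y) - y + 2 * δ ^ 2 * (1 - c)|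
      ≤ |Real.log (1 + y) - y| + |2 * δ ^ 2 * (1 - c)| := abs_add_le _ _
    _ ≤ 2 * y ^ 2 + 4 * δ ^ 2 := by
        refine add_le_add hlog ?_
        rw [abs_of_nonneg (by positivity)]
        nlinarith [sq_nonneg δ]
    _ ≤ 22 * δ ^ 2 := by
        have : y ^ 2 ≤ 9 * δ ^ 2 := by
          calc y ^ 2 = |y| ^ 2 := (sq_abs y).symm
            _ ≤ (3 * |δ|) ^ 2 := pow_le_pow_left₀ (abs_nonneg _) hy_abs 2
            _ = 9 * δ ^ 2 := by rw [mul_pow, sq_abs]; ring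
        linarith

/-! ### The reduced phase correction `πΦ = arctan(q/p)` and its partial derivatives -/

/-- `Φ` in the variable `δ`: `pcPhi x δ = π⁻¹ arctan(δ(1 - cos 2πx)/(1 - δ sin 2πx))`.
[cite: AjankiHuveneers2011, Lemma 3.2 eq. (3.10); App. 7.1] -/
def pcPhi (x δ : ℝ) : ℝ :=
  Real.arctan (δ * (1 - Real.cos (2 * π * x)) / (1 - δ * Real.sin (2 * π * x))) / π

/-- `1 - δ sin θ > 0` for `|δ| < 1`. [folklore] -/
theorem one_sub_delta_sin_pos {δ : ℝ} (hδ : |δ| < 1) (x : ℝ) : 0 < 1 - δ * Real.sin (2 * π * x) := by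
  have : |δ * Real.sin (2 * π * x)| ≤ |δ| := by
    rw [abs_mul]; exact mul_le_of_le_one_right (abs_nonneg _) (Real.abs_sin_le_one _)
  linarith [le_abs_self (δ * Real.sin (2 * π * x))]

/-- **`Φ = pcPhi ∘ igDelta`**: `ahPhi w x b = pcPhi x (δ(w,b))`, for `w ≥ 0`, `πw/2 < 1`
(`N = q₀ δ(1 - cos θ)`, `D = q₀ (1 - δ sin θ)`). [cite: AjankiHuveneers2011, Lemma 3.2 eq. (3.10); App. 7.1 (def. of `δ`)] -/
theorem ahPhi_eq_pcPhi {w : ℝ} (hw0 : 0 ≤ w) (hw : π * w / 2 < 1) (x b : ℝ) :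
    ahPhi w x b = pcPhi x (igDelta w b) := by
  have hq := igQ0_pos hw0 hw
  have hq' : Real.sqrt (1 - (π * w / 2) ^ 2) = igQ0 w := rfl
  have hN : ahNum w x b = igQ0 w * (igDelta w b * (1 - Real.cos (2 * π * x))) := by
    unfold ahNum igDelta igC
    field_simp
  have hD : ahDen w x b = igQ0 w * (1 - igDelta w b * Real.sin (2 * π * x)) := by
    unfold ahDen igDelta igC
    rw [hq']
    field_simp
  unfold ahPhi pcPhi
  rw [hN, hD, mul_div_mul_left _ _ hq.ne']

/-- The algebra behind `∂_x Φ = 1/P - 1`. [folklore] -/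
theorem pcPhi_x_identity {δ s c : ℝ} (hsc : s ^ 2 + c ^ 2 = 1) (hd : 1 - δ * s ≠ 0)
    (hP : (1 - δ * s) ^ 2 + (δ * (1 - c)) ^ 2 ≠ 0) :
    1 / (1 + (δ * (1 - c) / (1 - δ * s)) ^ 2) *
        ((δ * (2 * π * s)) * (1 - δ * s) - δ * (1 - c) * (-(δ * (2 * π * c)))) / (1 - δ * s) ^ 2 / π =
      1 / ((1 - δ * s) ^ 2 + (δ * (1 - c)) ^ 2) - 1 := by
  have hπ : π ≠ 0 := Real.pi_ne_zero
  have e1 : 1 / (1 + (δ * (1 - c) / (1 - δ * s)) ^ 2) *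
        ((δ * (2 * π * s)) * (1 - δ * s) - δ * (1 - c) * (-(δ * (2 * π * c)))) / (1 - δ * s) ^ 2 / π =
      ((δ * (2 * π * s)) * (1 - δ * s) - δ * (1 - c) * (-(δ * (2 * π * c)))) /
        (((1 - δ * s) ^ 2 + (δ * (1 - c)) ^ 2) * π) := by
    field_simp
  have e2 : 1 / ((1 - δ * s) ^ 2 + (δ * (1 - c)) ^ 2) - 1 =
      (1 - ((1 - δ * s) ^ 2 + (δ * (1 - c)) ^ 2)) / ((1 - δ * s) ^ 2 + (δ * (1 - c)) ^ 2) := by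
    field_simp
  rw [e1, e2, div_eq_div_iff (mul_ne_zero hP hπ) hP]
  linear_combination (-(π * δ ^ 2 * ((1 - δ * s) ^ 2 + (δ * (1 - c)) ^ 2))) * hsc

/-- **`∂_x Φ(x,b) = 1/P(x,δ) - 1`**, i.e. `∂_x f_b = 1/P = ahFactor⁻²`.
[cite: AjankiHuveneers2011, Lemma 3.2 eq. (3.10); App. 7.1] -/
theorem hasDerivAt_pcPhi_x {δ : ℝ} (hδ : |δ| < 1) (x : ℝ) :
    HasDerivAt (fun x => pcPhi x δ) (1 / pcP x δ - 1) x := by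
  have hd := one_sub_delta_sin_pos hδ x
  have hn : HasDerivAt (fun x => δ * (1 - Real.cos (2 * π * x))) (δ * -(-(2 * π * Real.sin (2 * π * x)))) x :=
    ((hasDerivAt_cos_two_pi x).const_sub 1).const_mul δ
  have hn' : HasDerivAt (fun x => δ * (1 - Real.cos (2 * π * x))) (δ * (2 * π * Real.sin (2 * π * x))) x :=
    hn.congr_deriv (by ring)
  have hd' : HasDerivAt (fun x => 1 - δ * Real.sin (2 * π * x)) (-(δ * (2 * π * Real.cos (2 * π * x)))) x :=
    ((hasDerivAt_sin_two_pi x).const_mul δ).const_sub 1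
  have hf : HasDerivAt (fun x => δ * (1 - Real.cos (2 * π * x)) / (1 - δ * Real.sin (2 * π * x)))
      ((δ * (2 * π * Real.sin (2 * π * x)) * (1 - δ * Real.sin (2 * π * x)) -
        δ * (1 - Real.cos (2 * π * x)) * -(δ * (2 * π * Real.cos (2 * π * x)))) /
        (1 - δ * Real.sin (2 * π * x)) ^ 2) x := hn'.div hd' hd.ne'
  have h := hf.arctan.div_const π
  have hsc := Real.sin_sq_add_cos_sq (2 * π * x)
  have hP := pcP_pos x δ
  rw [pcP_eq_sq] at hP
  have key := pcPhi_x_identity hsc hd.ne' hP.ne'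
  rw [← pcP_eq_sq] at key
  refine h.congr_deriv ?_
  rw [← key]
  ring

/-- **`∂_δ Φ(x,·) = (1 - cos 2πx)/(πP)`** (so `∂_b f_b(x) = c(w)(1 - cos 2πx)/(πP) ≈ w sin²πx`).
[cite: AjankiHuveneers2011, Lemma 3.2 eqs. (3.10)-(3.11)] -/
theorem hasDerivAt_pcPhi_delta {δ : ℝ} (hδ : |δ| < 1) (x : ℝ) :
    HasDerivAt (fun δ => pcPhi x δ) ((1 - Real.cos (2 * π * x)) / (π * pcP x δ)) δ := by
  have hd := one_sub_delta_sin_pos hδ x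
  have hn : HasDerivAt (fun δ : ℝ => δ * (1 - Real.cos (2 * π * x))) (1 * (1 - Real.cos (2 * π * x))) δ :=
    (hasDerivAt_id' δ).mul_const _
  have hd' : HasDerivAt (fun δ : ℝ => 1 - δ * Real.sin (2 * π * x)) (-(1 * Real.sin (2 * π * x))) δ :=
    ((hasDerivAt_id' δ).mul_const _).const_sub 1
  have hf : HasDerivAt (fun δ : ℝ => δ * (1 - Real.cos (2 * π * x)) / (1 - δ * Real.sin (2 * π * x)))
      ((1 * (1 - Real.cos (2 * π * x)) * (1 - δ * Real.sin (2 * π * x)) -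
        δ * (1 - Real.cos (2 * π * x)) * -(1 * Real.sin (2 * π * x))) /
        (1 - δ * Real.sin (2 * π * x)) ^ 2) δ := hn.div hd' hd.ne'
  have h := hf.arctan.div_const π
  have hP := pcP_pos x δ
  have hPsq := pcP_eq_sq x δ
  have hd0 : (1 - δ * Real.sin (2 * π * x)) ≠ 0 := hd.ne'
  have hP0 : (1 - δ * Real.sin (2 * π * x)) ^ 2 + (δ * (1 - Real.cos (2 * π * x))) ^ 2 ≠ 0 := by
    rw [← hPsq]; exact hP.ne'
  have key : 1 / (1 + (δ * (1 - Real.cos (2 * π * x)) / (1 - δ * Real.sin (2 * π * x))) ^ 2) *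
      ((1 * (1 - Real.cos (2 * π * x)) * (1 - δ * Real.sin (2 * π * x)) -
        δ * (1 - Real.cos (2 * π * x)) * -(1 * Real.sin (2 * π * x))) /
        (1 - δ * Real.sin (2 * π * x)) ^ 2) / π = (1 - Real.cos (2 * π * x)) / (π * pcP x δ) := by
    rw [hPsq]
    field_simp
    ring
  exact h.congr_deriv key

/-! ### The one-step map `f_b(x) = x + ϑ + Φ(x,b)`: derivatives in `x` and in `b` -/

/-- **`∂_x f_b(x) = 1/P(x, δ(w,b))`**. [cite: AjankiHuveneers2011, Lemma 3.2 eq. (3.8)] -/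
theorem hasDerivAt_ahStep_x {w b : ℝ} (hw0 : 0 ≤ w) (hw : π * w / 2 < 1) (hδ : |igDelta w b| < 1)
    (x : ℝ) : HasDerivAt (fun x => ahStep w b x) (1 / pcP x (igDelta w b)) x := by
  have hfun : (fun x => ahStep w b x) = fun x => x + ahTheta w + pcPhi x (igDelta w b) := by
    funext y
    rw [ahStep, ahPhi_eq_pcPhi hw0 hw]
  rw [hfun]
  have h := (((hasDerivAt_id' x).add_const (ahTheta w)).add (hasDerivAt_pcPhi_x hδ x))
  exact h.congr_deriv (by ring)

/-- **`∂_b f_b(x) = c(w)(1 - cos 2πx)/(πP(x, δ(w,b)))`**. [cite: AjankiHuveneers2011, Lemma 3.2 eqs. (3.8), (3.11)] -/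
theorem hasDerivAt_ahStep_b {w x b : ℝ} (hw0 : 0 ≤ w) (hw : π * w / 2 < 1) (hδ : |igDelta w b| < 1) :
    HasDerivAt (fun b => ahStep w b x)
      (igC w * (1 - Real.cos (2 * π * x)) / (π * pcP x (igDelta w b))) b := by
  have hfun : (fun b => ahStep w b x) = fun b => x + ahTheta w + pcPhi x (igC w * b) := by
    funext b'
    rw [ahStep, ahPhi_eq_pcPhi hw0 hw]
    rfl
  rw [hfun]
  have hlin : HasDerivAt (fun b : ℝ => igC w * b) (igC w) b := by
    simpa using (hasDerivAt_id b).const_mul (igC w)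
  have hδ' : |igC w * b| < 1 := hδ
  have hcomp : HasDerivAt (fun b : ℝ => pcPhi x (igC w * b))
      ((1 - Real.cos (2 * π * x)) / (π * pcP x (igC w * b)) * igC w) b :=
    (hasDerivAt_pcPhi_delta hδ' x).comp b hlin
  have h := hcomp.const_add (x + ahTheta w)
  refine h.congr_deriv ?_
  unfold igDelta
  ring

/-! ### The amplitude factor is `√P` -/

/-- **`ahFactor = √P`**: the amplitude factor of (3.14) is the square root of the Jacobian's
inverse. [cite: AjankiHuveneers2011, Prop. 3.5 eq. (3.19); App. 7.1] -/
theorem ahFactor_eq_sqrt_pcP {w x b : ℝ} (hw0 : 0 ≤ w) (hwb : π * w / 2 * (1 + |b|) < 1) :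
    ahFactor w x b = Real.sqrt (pcP x (igDelta w b)) := by
  have h := ig_ahFactor_inv_eq (x := x) hw0 hwb
  rw [← pcP_eq_half_angle] at h
  have hs : 0 < Real.sqrt (pcP x (igDelta w b)) := Real.sqrt_pos.mpr (pcP_pos _ _)
  have hf : 0 < ahFactor w x b := ig_ahFactor_pos hw0 hwb
  rw [one_div] at h
  exact inv_injective h

/-- `ahFactor² = P`. [cite: AjankiHuveneers2011, App. 7.1] -/
theorem ahFactor_sq_eq_pcP {w x b : ℝ} (hw0 : 0 ≤ w) (hwb : π * w / 2 * (1 + |b|) < 1) :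
    ahFactor w x b ^ 2 = pcP x (igDelta w b) := by
  rw [ahFactor_eq_sqrt_pcP hw0 hwb, Real.sq_sqrt (pcP_pos _ _).le]

/-! ### Smallness bookkeeping and the size of `∂_b f_b` -/

/-- `c(w) ≥ πw/2` (`q₀ ≤ 1`). [folklore] -/
theorem le_igC {w : ℝ} (hw0 : 0 ≤ w) (hw : π * w / 2 < 1) : π * w / 2 ≤ igC w := by
  have hq := igQ0_pos hw0 hw
  have hq1 := igQ0_le_one w
  unfold igC
  rw [le_div_iff₀ hq]
  nlinarith [mul_nonneg (by positivity : (0:ℝ) ≤ π * w / 2) hq.le]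

/-- `|δ(w,b)| ≤ πw|b|` for `πw/2 ≤ 1/2`. [folklore] -/
theorem abs_igDelta_le {w : ℝ} (hw0 : 0 ≤ w) (hw : π * w / 2 ≤ 1 / 2) (b : ℝ) :
    |igDelta w b| ≤ π * w * |b| := by
  unfold igDelta
  rw [abs_mul, abs_of_nonneg (igC_nonneg hw0 (by linarith))]
  exact mul_le_mul_of_nonneg_right (igC_le hw0 hw) (abs_nonneg b)

/-- The smallness threshold of this file: `w_pc(M) = 1/(8π(M+1))`; for `0 ≤ w ≤ w_pc(M)` and
`|b| ≤ M` one has `πw/2 ≤ 1/2`, `(πw/2)(1+|b|) < 1` and `|δ(w,b)| ≤ 1/8`. [folklore] -/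
def pcW (M : ℝ) : ℝ := 1 / (8 * π * (M + 1))

/-- `w_pc(M) > 0`. [folklore] -/
theorem pcW_pos {M : ℝ} (hM : 0 ≤ M) : 0 < pcW M := by unfold pcW; positivity

/-- Consequences of `w ≤ w_pc(M)`, `|b| ≤ M`. [folklore] -/
theorem pc_small {M w b : ℝ} (hM : 0 ≤ M) (hw0 : 0 ≤ w) (hw : w ≤ pcW M) (hb : |b| ≤ M) :
    π * w / 2 ≤ 1 / 2 ∧ π * w / 2 * (1 + |b|) < 1 ∧ |igDelta w b| ≤ 1 / 8 := by
  have hπ := Real.pi_pos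
  have h1 : π * w * (M + 1) ≤ 1 / 8 := by
    unfold pcW at hw
    rw [le_div_iff₀ (by positivity)] at hw
    nlinarith
  have hwM : π * w ≤ 1 / 8 := by nlinarith [mul_nonneg (mul_nonneg hπ.le hw0) hM]
  refine ⟨by nlinarith, ?_, ?_⟩
  · have h2 : π * w * (1 + |b|) ≤ π * w * (M + 1) :=
      mul_le_mul_of_nonneg_left (by linarith) (by positivity)
    nlinarith
  · calc |igDelta w b| ≤ π * w * |b| := abs_igDelta_le hw0 (by nlinarith) b
      _ ≤ π * w * M := mul_le_mul_of_nonneg_left hb (by positivity)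
      _ ≤ 1 / 8 := by nlinarith [mul_nonneg hπ.le hw0]

/-- **`w sin²(πx)/2 ≤ ∂_b f_b(x) ≤ 4w`** in the small regime. [cite: AjankiHuveneers2011, Lemma 3.2 eq. (3.11) (`Φ = wb sin²πx + …`)] -/
theorem ahStep_b_deriv_bounds {M w b : ℝ} (hM : 0 ≤ M) (hw0 : 0 ≤ w) (hw : w ≤ pcW M) (hb : |b| ≤ M)
    (x : ℝ) :
    w * Real.sin (π * x) ^ 2 / 2 ≤ igC w * (1 - Real.cos (2 * π * x)) / (π * pcP x (igDelta w b)) ∧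
      igC w * (1 - Real.cos (2 * π * x)) / (π * pcP x (igDelta w b)) ≤ 4 * w := by
  obtain ⟨hw2, -, hδ⟩ := pc_small hM hw0 hw hb
  have hπ := Real.pi_pos
  obtain ⟨hPlo, hPhi⟩ := pcP_bounds (by linarith : |igDelta w b| ≤ 1 / 4) x
  have hc_lo := le_igC hw0 (by linarith)
  have hc_hi := igC_le hw0 hw2
  have hcos : 1 - Real.cos (2 * π * x) = 2 * Real.sin (π * x) ^ 2 := by
    rw [show 2 * π * x = 2 * (π * x) by ring, Real.cos_two_mul, Real.cos_sq']; ring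
  have h1c0 : 0 ≤ 1 - Real.cos (2 * π * x) := by linarith [Real.cos_le_one (2 * π * x)]
  have h1c2 : 1 - Real.cos (2 * π * x) ≤ 2 := by linarith [Real.neg_one_le_cos (2 * π * x)]
  have hden : 0 < π * pcP x (igDelta w b) := by positivity
  constructor
  · rw [div_le_div_iff₀ (by norm_num : (0:ℝ) < 2) hden, hcos]
    have hS := sq_nonneg (Real.sin (π * x))
    calc w * Real.sin (π * x) ^ 2 * (π * pcP x (igDelta w b))
        ≤ w * Real.sin (π * x) ^ 2 * (π * 2) :=
          mul_le_mul_of_nonneg_left (mul_le_mul_of_nonneg_left hPhi hπ.le) (by positivity)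
      _ = 4 * (π * w / 2) * Real.sin (π * x) ^ 2 := by ring
      _ ≤ 4 * igC w * Real.sin (π * x) ^ 2 := by gcongr
      _ = igC w * (2 * Real.sin (π * x) ^ 2) * 2 := by ring
  · rw [div_le_iff₀ hden]
    calc igC w * (1 - Real.cos (2 * π * x)) ≤ (π * w) * 2 :=
          mul_le_mul hc_hi h1c2 h1c0 (by positivity)
      _ ≤ 4 * w * (π * pcP x (igDelta w b)) := by nlinarith [mul_nonneg hπ.le hw0]

end Literature.Barriers.AtomisticToContinuum.HeatConduction

end
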